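import Literature.AlgebraicGeometry.Motives.HodgeLieWeightOnePlusPairTwinIdeal
import Literature.AlgebraicGeometry.Motives.HodgeLieWeightOnePlusPairKilling
import Literature.Algebra.Lie.Sl2TripleOfDimensionThree
import Literature.Algebra.Lie.Sl2ModuleTraceParity
import HarnessLib

/-!
# Weight one, plus pair: `Lie Hg ⊗ ℂ` is a Killing algebra, and a three-dimensional twin ideal is an `𝔰𝔩₂`
# (Jacobson X §1 + I §4; Moonen–Zarhin (2.3))

Topic `Literature/AlgebraicGeometry/Motives` (namespace `Literature.AlgebraicGeometry.Motives.HodgeStructure`).  Theorems only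
(no definition, no named fact; D-0026).  Sequel of `HodgeLieWeightOnePlusPairTwinIdeal` (the twin ideal `W`),
`HodgeLieWeightOnePlusPairKilling` (`8 tr_{V_ℂ}(xy) = dim V · κ(x, y)`) and `Literature.Algebra.Lie.Sl2TripleOfDimensionThree`,
written for the cell `pub-hodge-ring2` (literature lane gen 67, programme R44 step F3i; honest framing of that cell: research
route conditional on HC_CM; not a corollary; Q11.4-sentence-2 already refuted in dim ≥ 3 — this file is unconditional).

* `isKilling_of_plusLine` — in the plus-line position with `𝔷 = 0`, every complex Lie algebra with carrier `𝔥_ℂ` is KILLING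
  (`Lie Hg` is `ℚ`-simple, `ℂ ⊗_ℚ Lie Hg ≃ 𝔥_ℂ`, semisimplicity passes to the base change and along the isomorphism).
* `exists_sl2Triple_of_twin` — a three-dimensional `ad 𝔥_ℂ`-stable `W` with an `ad`-stable complement `C`, `[W, C] = 0`, is spanned
  by an `sl₂`-triple `(h', e', f')` of operators: the trace form `tr_{V_ℂ}(xy)` is non-degenerate on `W` (it is `(dim V/8) κ`, and
  `κ(C, W) = 0`) and `W` is centre-free (`κ` non-degenerate), so `Sl2OfDimThree.exists_isSl2Triple_of_finrank_eq_three` applies.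

## References

* [Jacobson1962LieAlgebras] N. Jacobson, *Lie Algebras* (1962), Ch. I §4; Ch. III §4 (Cartan's criterion); Ch. X §1.
* [MoonenZarhin1999LowDim] B. Moonen, Yu. Zarhin, *Hodge classes on abelian varieties of low dimension* (1999), §2 (2.3).
* [Deligne1982HodgeCycles] P. Deligne, *Hodge cycles on abelian varieties*, LNM 900 (1982), I §3, Prop. 3.6.
* [Humphreys1972] J. E. Humphreys, *Introduction to Lie Algebras and Representation Theory* (1972), §5.1, §8.3.
-/

open scoped TensorProduct

namespace Literature.AlgebraicGeometry.Motives

open Module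
open Literature.Algebra.Lie

universe u

variable {V : Type u} [AddCommGroup V] [Module ℚ V] [Module.Finite ℚ V] [HodgeTensorFacts.{u, u}] {n : ℤ}

namespace HodgeStructure

set_option maxHeartbeats 400000 in
/-- **In the plus-line position with `𝔷 = 0`, `𝔥_ℂ = Lie Hg ⊗ ℂ` is a Killing (hence semisimple) Lie algebra**: `Lie Hg` is
`ℚ`-simple (`isSimple_hodgeLie_of_plusLine`), so `ℂ ⊗_ℚ Lie Hg` is semisimple (`KillingBaseChange.isSemisimple_baseChange`),
i.e. Killing (characteristic `0`), and `ℂ ⊗_ℚ Lie Hg ≃ 𝔥_ℂ` (`exists_lieEquiv_baseChange_spanC`, `LieAlgebra.isKilling_of_equiv`).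
[cite: Jacobson1962LieAlgebras, Ch. III §4 and Ch. X §1] [cite: Deligne1982HodgeCycles, I §3 Prop. 3.6] -/
theorem isKilling_of_plusLine (H : HodgeStructure V n) (ψ : H.Polarization) (hn : n = 1)
    (heff : H.IsEffective) {Θ : Module.End ℂ (ℂ ⊗[ℚ] V)}
    (hΘ : ∀ p, ∀ x ∈ H.piece p (n - p), Θ x = ((2 * p - n : ℤ) : ℂ) • x)
    {B₀ C₀ : Module.End ℂ (ℂ ⊗[ℚ] V)} (hB₀ : B₀ ∈ H.hodgeLieC) (hB₀0 : B₀ ≠ 0)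
    (hB₀P : ∀ p ∈ H.piece 1 0, B₀ p = 0) (hB₀im : ∀ v, B₀ v ∈ H.piece 1 0)
    (hC₀ : ∀ v, C₀ v = conj (B₀ (conj v))) {μ₀ : ℂ} (hμ₀ : μ₀ ≠ 0)
    (hBC : ∀ p ∈ H.piece 1 0, B₀ (C₀ p) = μ₀ • p) (hCB : ∀ q ∈ H.piece 0 1, C₀ (B₀ q) = μ₀ • q)
    (hline : ∀ B ∈ H.hodgeLieC, (∀ p ∈ H.piece 1 0, B p = 0) → (∀ v, B v ∈ H.piece 1 0) → ∃ c : ℂ, B = c • B₀)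
    (hz : H.hodgeLie ⊓ Subalgebra.toSubmodule H.endAlg = ⊥) :
    letI : LieRing (Module.End ℂ (ℂ ⊗[ℚ] V)) := LieRing.ofAssociativeRing
    ∀ 𝔏' : LieSubalgebra ℂ (Module.End ℂ (ℂ ⊗[ℚ] V)), 𝔏'.toSubmodule = H.hodgeLieC → LieAlgebra.IsKilling ℂ 𝔏' := by
  letI iQ : LieRing (Module.End ℚ V) := LieRing.ofAssociativeRing
  letI iC : LieRing (Module.End ℂ (ℂ ⊗[ℚ] V)) := LieRing.ofAssociativeRing
  intro 𝔏' h𝔏'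
  obtain ⟨𝔏, h𝔏⟩ := exists_lieSubalgebra_eq_hodgeLie H
  haveI hsimple : LieAlgebra.IsSimple ℚ 𝔏 :=
    isSimple_hodgeLie_of_plusLine H ψ hn heff hΘ hB₀ hB₀0 hB₀P hB₀im hC₀ hμ₀ hBC hCB hline hz 𝔏 h𝔏
  haveI : Module.Finite ℚ 𝔏 := Module.Finite.of_injective 𝔏.toSubmodule.subtype Subtype.val_injective
  have hspan : 𝔏'.toSubmodule = spanC 𝔏.toSubmodule := by rw [h𝔏', h𝔏, hodgeLieC_eq_spanC]
  obtain ⟨e, -⟩ := exists_lieEquiv_baseChange_spanC 𝔏 𝔏' hspan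
  haveI hss : LieAlgebra.IsSemisimple ℂ (ℂ ⊗[ℚ] 𝔏) :=
    KillingBaseChange.isSemisimple_baseChange (k := ℚ) (K := ℂ) (L := 𝔏)
  haveI : LieAlgebra.IsKilling ℂ (ℂ ⊗[ℚ] 𝔏) := KillingBaseChange.isSemisimple_iff_isKilling.1 hss
  exact LieAlgebra.isKilling_of_equiv e

set_option maxHeartbeats 800000 in
/-- **A three-dimensional twin ideal of `𝔥_ℂ` is spanned by an `sl₂`-triple of operators.**  In the plus-line position with
`𝔷 = 0`, let `𝔥_ℂ = W ⊕ C` with `ad 𝔥_ℂ`-stable `W`, `C`, `[W, C] = 0` and `dim W = 3` (`exists_twin_ideal_of_plusPair`).  Then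
there are `h', e', f' ∈ W` with `[h', e'] = 2e'`, `[h', f'] = −2f'`, `[e', f'] = h'`, spanning `W`.  The trace form of `V_ℂ`
restricted to `W` is non-degenerate: `8 tr(xy) = dim V · κ(x, y)` on `𝔥_ℂ` (`eight_mul_trace_mul_eq_finrank_mul_killingForm_of_plusPair`),
`κ(c, w) = tr(ad c ∘ ad w) = 0` for `c ∈ C`, `w ∈ W` (`ad c ∘ ad w = 0`), and `κ` is non-degenerate (`isKilling_of_plusLine`);
likewise `W` is centre-free; conclude by `Sl2OfDimThree.exists_isSl2Triple_of_finrank_eq_three`.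
[cite: Jacobson1962LieAlgebras, Ch. I §4] [cite: MoonenZarhin1999LowDim, §2 (2.3)] [cite: Humphreys1972, §8.3] -/
theorem exists_sl2Triple_of_twin (H : HodgeStructure V n) (ψ : H.Polarization) (hn : n = 1)
    (heff : H.IsEffective) {Θ : Module.End ℂ (ℂ ⊗[ℚ] V)}
    (hΘ : ∀ p, ∀ x ∈ H.piece p (n - p), Θ x = ((2 * p - n : ℤ) : ℂ) • x)
    {B₀ C₀ : Module.End ℂ (ℂ ⊗[ℚ] V)} (hB₀ : B₀ ∈ H.hodgeLieC) (hB₀0 : B₀ ≠ 0)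
    (hB₀P : ∀ p ∈ H.piece 1 0, B₀ p = 0) (hB₀im : ∀ v, B₀ v ∈ H.piece 1 0)
    (hC₀ : ∀ v, C₀ v = conj (B₀ (conj v))) {μ₀ : ℂ} (hμ₀ : μ₀ ≠ 0)
    (hBC : ∀ p ∈ H.piece 1 0, B₀ (C₀ p) = μ₀ • p) (hCB : ∀ q ∈ H.piece 0 1, C₀ (B₀ q) = μ₀ • q)
    (hline : ∀ B ∈ H.hodgeLieC, (∀ p ∈ H.piece 1 0, B p = 0) → (∀ v, B v ∈ H.piece 1 0) → ∃ c : ℂ, B = c • B₀)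
    (hline' : ∀ C ∈ H.hodgeLieC, (∀ q ∈ H.piece 0 1, C q = 0) → (∀ v, C v ∈ H.piece 0 1) → ∃ c : ℂ, C = c • C₀)
    (hz : H.hodgeLie ⊓ Subalgebra.toSubmodule H.endAlg = ⊥)
    {W C : Submodule ℂ (Module.End ℂ (ℂ ⊗[ℚ] V))} (hWle : W ≤ H.hodgeLieC) (hCle : C ≤ H.hodgeLieC)
    (hWC : W ⊔ C = H.hodgeLieC) (hW3 : Module.finrank ℂ W = 3)
    (hWst : ∀ Y ∈ H.hodgeLieC, ∀ w ∈ W, Y * w - w * Y ∈ W) (hcommWC : ∀ w ∈ W, ∀ c ∈ C, w * c = c * w) :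
    ∃ h' e' f' : Module.End ℂ (ℂ ⊗[ℚ] V), h' ∈ W ∧ e' ∈ W ∧ f' ∈ W ∧
      h' * e' - e' * h' = (2 : ℂ) • e' ∧ h' * f' - f' * h' = -((2 : ℂ) • f') ∧ e' * f' - f' * e' = h' ∧
      ∀ w ∈ W, ∃ a b c : ℂ, w = a • h' + b • e' + c • f' := by
  classical
  letI iC : LieRing (Module.End ℂ (ℂ ⊗[ℚ] V)) := LieRing.ofAssociativeRing
  obtain ⟨𝔏', h𝔏'⟩ := exists_lieSubalgebra_eq_hodgeLieC H
  have hmem𝔏' : ∀ {x}, x ∈ 𝔏' ↔ x ∈ H.hodgeLieC := fun {x} => by rw [← LieSubalgebra.mem_toSubmodule, h𝔏']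
  haveI hK : LieAlgebra.IsKilling ℂ 𝔏' :=
    isKilling_of_plusLine H ψ hn heff hΘ hB₀ hB₀0 hB₀P hB₀im hC₀ hμ₀ hBC hCB hline hz 𝔏' h𝔏'
  have hkill := eight_mul_trace_mul_eq_finrank_mul_killingForm_of_plusPair H ψ hn heff hΘ hB₀ hB₀0 hB₀P hB₀im hC₀ hμ₀
    hBC hCB hline hline' hz 𝔏' h𝔏'
  -- `dim V ≠ 0`
  have hd : (Module.finrank ℚ V : ℂ) ≠ 0 := by
    have hpos : 0 < Module.finrank ℂ (ℂ ⊗[ℚ] V) := by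
      rw [Module.finrank_pos_iff]
      by_contra hnt
      rw [not_nontrivial_iff_subsingleton] at hnt
      exact hB₀0 (Subsingleton.elim _ _)
    rw [Module.finrank_baseChange] at hpos
    exact_mod_cast hpos.ne'
  -- `κ(c, w) = 0` for `c ∈ C`, `w ∈ W`, and `κ(z, x) = 0` when `x ∈ W` commutes with `W`
  have hbrW : ∀ w ∈ W, ∀ z ∈ H.hodgeLieC, w * z - z * w ∈ W := fun w hw z hz' => by
    rw [← neg_sub]; exact W.neg_mem (hWst z hz' w hw)
  have hadad : ∀ (c' x' : 𝔏'), (∀ w ∈ W, (c' : Module.End ℂ (ℂ ⊗[ℚ] V)) * w = w * c') →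
      (x' : Module.End ℂ (ℂ ⊗[ℚ] V)) ∈ W → killingForm ℂ 𝔏' c' x' = 0 := by
    intro c' x' hc' hx'
    rw [killingForm, LieModule.traceForm_apply_apply]
    have h0 : (LieModule.toEnd ℂ 𝔏' 𝔏' c') ∘ₗ (LieModule.toEnd ℂ 𝔏' 𝔏' x') = 0 := by
      refine LinearMap.ext fun z => ?_
      rw [LinearMap.comp_apply, LinearMap.zero_apply]
      change ⁅c', ⁅x', z⁆⁆ = 0
      apply Subtype.ext
      rw [LieSubalgebra.coe_bracket, LieSubalgebra.coe_bracket, LieRing.of_associative_ring_bracket,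
        LieRing.of_associative_ring_bracket, ZeroMemClass.coe_zero]
      have hmem : (x' : Module.End ℂ (ℂ ⊗[ℚ] V)) * z - z * x' ∈ W := hbrW _ hx' _ (hmem𝔏'.1 z.2)
      rw [hc' _ hmem, sub_self]
    rw [h0, map_zero]
  have hkill0 : ∀ x' : 𝔏', (∀ z' : 𝔏', killingForm ℂ 𝔏' z' x' = 0) → x' = 0 := fun x' hx' => by
    have h : x' ∈ LinearMap.ker (killingForm ℂ 𝔏') := by
      rw [LinearMap.mem_ker]
      ext z'
      rw [LinearMap.zero_apply, ← LieModule.traceForm_comm]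
      exact hx' z'
    rwa [LieAlgebra.IsKilling.ker_killingForm_eq_bot, Submodule.mem_bot] at h
  -- the Lie algebra `W𝔩` with carrier `W`
  let W𝔩 : LieSubalgebra ℂ (Module.End ℂ (ℂ ⊗[ℚ] V)) :=
    { W with
      lie_mem' := fun {a b} ha hb => by
        rw [LieRing.of_associative_ring_bracket]
        exact hWst a (hWle ha) b hb }
  have hmemW𝔩 : ∀ {x}, x ∈ W𝔩 ↔ x ∈ W := fun {x} => Iff.rfl
  haveI : Module.Finite ℂ W𝔩 := Module.Finite.of_injective W𝔩.toSubmodule.subtype Subtype.val_injective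
  have h3 : Module.finrank ℂ W𝔩 = 3 := hW3
  -- the trace form on `W𝔩`
  obtain ⟨B, hB⟩ : ∃ B : LinearMap.BilinForm ℂ W𝔩, B = LieModule.traceForm ℂ W𝔩 (ℂ ⊗[ℚ] V) := ⟨_, rfl⟩
  have hBapply : ∀ x y : W𝔩, B x y =
      LinearMap.trace ℂ (ℂ ⊗[ℚ] V) ((x : Module.End ℂ (ℂ ⊗[ℚ] V)) * y) := by
    intro x y
    rw [hB, LieModule.traceForm_apply_apply]
    rfl
  have hBs : B.IsSymm := ⟨fun x y => by rw [hBapply, hBapply, LinearMap.trace_mul_comm]⟩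
  have hBi : B.lieInvariant W𝔩 := by rw [hB]; exact LieModule.traceForm_lieInvariant ℂ W𝔩 (ℂ ⊗[ℚ] V)
  -- non-degenerate
  have hR : B.SeparatingRight := by
    intro y hy
    have hyW : (y : Module.End ℂ (ℂ ⊗[ℚ] V)) ∈ W := y.2
    set y' : 𝔏' := ⟨y, hmem𝔏'.2 (hWle hyW)⟩ with hy'
    have hy'0 : y' = 0 := by
      refine hkill0 y' fun z' => ?_
      have hz : (z' : Module.End ℂ (ℂ ⊗[ℚ] V)) ∈ W ⊔ C := by rw [hWC]; exact hmem𝔏'.1 z'.2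
      obtain ⟨w, hw, c, hc, hwc⟩ := Submodule.mem_sup.1 hz
      have hc𝔏 : c ∈ 𝔏' := hmem𝔏'.2 (hCle hc)
      have hw𝔏 : w ∈ 𝔏' := hmem𝔏'.2 (hWle hw)
      have hz' : z' = ⟨w, hw𝔏⟩ + ⟨c, hc𝔏⟩ := Subtype.ext hwc.symm
      have hcw : killingForm ℂ 𝔏' ⟨c, hc𝔏⟩ y' = 0 :=
        hadad ⟨c, hc𝔏⟩ y' (fun w' hw' => (hcommWC w' hw' c hc).symm) hyW
      have hww : killingForm ℂ 𝔏' ⟨w, hw𝔏⟩ y' = 0 := by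
        have h8 := hkill ⟨w, hw𝔏⟩ y'
        have htr : LinearMap.trace ℂ (ℂ ⊗[ℚ] V) (w * (y : Module.End ℂ (ℂ ⊗[ℚ] V))) = 0 := by
          rw [← hBapply ⟨w, hw⟩ y]; exact hy ⟨w, hw⟩
        have h8' : (8 : ℂ) * LinearMap.trace ℂ (ℂ ⊗[ℚ] V) (w * (y : Module.End ℂ (ℂ ⊗[ℚ] V))) =
            (Module.finrank ℚ V : ℂ) * killingForm ℂ 𝔏' ⟨w, hw𝔏⟩ y' := h8
        rw [htr, mul_zero] at h8'
        exact (mul_eq_zero.1 h8'.symm).resolve_left hd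
      rw [hz', map_add, LinearMap.add_apply, hww, hcw, add_zero]
    exact Subtype.ext (congrArg (fun t : 𝔏' => (t : Module.End ℂ (ℂ ⊗[ℚ] V))) hy'0)
  have hBn : B.Nondegenerate := ⟨fun x hx => hR x fun y => by rw [hBs.eq y x]; exact hx y, hR⟩
  -- centre-free
  have hzk : ∀ x : W𝔩, (∀ y : W𝔩, ⁅x, y⁆ = 0) → x = 0 := by
    intro x hx
    have hxW : (x : Module.End ℂ (ℂ ⊗[ℚ] V)) ∈ W := x.2
    set x' : 𝔏' := ⟨x, hmem𝔏'.2 (hWle hxW)⟩ with hx'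
    have hcomm : ∀ w ∈ W, (x : Module.End ℂ (ℂ ⊗[ℚ] V)) * w = w * x := fun w hw => by
      have h := hx ⟨w, hw⟩
      rw [← LieSubalgebra.coe_zero_iff_zero, LieSubalgebra.coe_bracket, LieRing.of_associative_ring_bracket] at h
      exact sub_eq_zero.1 h
    have hx'0 : x' = 0 := by
      refine hkill0 x' fun z' => ?_
      -- `ad x' = 0`, so `κ(z', x') = 0`
      rw [killingForm, LieModule.traceForm_apply_apply]
      have h0 : LieModule.toEnd ℂ 𝔏' 𝔏' x' = 0 := by
        refine LinearMap.ext fun z => ?_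
        rw [LinearMap.zero_apply]
        change ⁅x', z⁆ = 0
        apply Subtype.ext
        rw [LieSubalgebra.coe_bracket, LieRing.of_associative_ring_bracket, ZeroMemClass.coe_zero]
        have hz : (z : Module.End ℂ (ℂ ⊗[ℚ] V)) ∈ W ⊔ C := by rw [hWC]; exact hmem𝔏'.1 z.2
        obtain ⟨w, hw, c, hc, hwc⟩ := Submodule.mem_sup.1 hz
        rw [← hwc, mul_add, add_mul, hcomm w hw, hcommWC _ hxW c hc, sub_self]
      rw [h0, LinearMap.comp_zero, map_zero]
    exact Subtype.ext (congrArg (fun t : 𝔏' => (t : Module.End ℂ (ℂ ⊗[ℚ] V))) hx'0)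
  -- the `sl₂`-triple
  obtain ⟨h₀, e₀, f₀, ht, hspan⟩ := Sl2OfDimThree.exists_isSl2Triple_of_finrank_eq_three h3 hBs hBn hBi hzk
  have hHE := congrArg (fun T : W𝔩 => (T : Module.End ℂ (ℂ ⊗[ℚ] V))) (ht.lie_h_e_smul ℂ)
  have hHF := congrArg (fun T : W𝔩 => (T : Module.End ℂ (ℂ ⊗[ℚ] V))) (ht.lie_lie_smul_f ℂ)
  have hEF := congrArg (fun T : W𝔩 => (T : Module.End ℂ (ℂ ⊗[ℚ] V))) ht.lie_e_f
  simp only [LieSubalgebra.coe_bracket, LieRing.of_associative_ring_bracket, SetLike.val_smul,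
    NegMemClass.coe_neg] at hHE hHF hEF
  refine ⟨h₀, e₀, f₀, h₀.2, e₀.2, f₀.2, hHE, hHF, hEF, fun w hw => ?_⟩
  obtain ⟨a, b, c, habc⟩ := hspan ⟨w, hw⟩
  refine ⟨a, b, c, ?_⟩
  have h := congrArg (fun T : W𝔩 => (T : Module.End ℂ (ℂ ⊗[ℚ] V))) habc
  simpa only [AddMemClass.coe_add, SetLike.val_smul] using h

end HodgeStructure

end Literature.AlgebraicGeometry.Motives
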